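import Literature.Topology.FourManifolds.TubeSurgery
import Literature.Topology.FourManifolds.HomotopyBallSlice
import Literature.Topology.FourManifolds.KnotFraming
import HarnessLib

/-!
# The open trace of a framed knot: `ℝ⁴` with an open `2`-handle, as a glued smooth `4`-manifold

Topic `Literature/Topology/FourManifolds`; first stage of the leaf (T)
`Literature.Topology.FourManifolds.Knot.exists_openTrace_of_isIntegralSurgery` of
`ZeroSurgeryHomotopyBallSliceConstruction.lean` (fact seat
`provefact-Literature.Topology.FourManifolds.Knot.M-13335a6642`, Manolescu–Piccirillo Lemma 3.3 for
`W = S⁴`). That leaf asks for a Hausdorff smooth `4`-manifold `T` containing a slice-disc datum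
`(e, f)` for the knot (`Knot.IsSliceDiscIn T e f`: a smoothly embedded `ℝ⁴` whose closed unit ball is
the `0`-handle, and the core disc of the `2`-handle) whose complement is an open collar `Y × ℝ` of an
`m`-surgery `Y`. This file constructs the manifold and the datum; the collar is left to the sequel.

## Construction

Let `ν : 𝕊¹ × ℝ² ↪ S³` be a tube around the circle `c` (`Literature.Topology.FourManifolds.TubeNbhd`,
`TubeSurgery.lean`; for a knot `K`, `ν = ν_K.toTubeNbhd` for an oriented tubular neighbourhood
`ν_K`, whose framing integer is then the framing of the handle). The **open trace**
`TubeNbhd.OpenTrace ν` is the pushout (`Literature.Topology.FourManifolds.SmoothGlueData.Glued`,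
`GluingConstruction.lean`) of

* the `0`-handle chart `ℝ⁴` (containing `B̄⁴` and the cone `{t • a | t > 0, a ∈ ν(𝕊¹ × ℝ²)}` over
  the tube), and
* the `2`-handle chart `ℝ²_x × ℝ²_w` (core plane `w = 0`, cocore plane `x = 0`),

along the partial diffeomorphism `traceGlue : t • ν(u, w) ↦ (t⁻¹ • u, w)` of the open cone onto
`{x ≠ 0}` (`traceFwd`, inverse `traceBwd (x, w) = ‖x‖⁻¹ • ν(x/‖x‖, w)`; both `C^∞`,
`contMDiffOn_traceFwd/Bwd`). Thus the handle chart is attached to `ℝ⁴` along all of `x ≠ 0`, the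
sphere `‖x‖ = 1` going to the tube `ν(𝕊¹ × ℝ²) ⊆ S³`, the punctured disc `0 < ‖x‖ < 1` to the cone
outside the ball, `‖x‖ > 1` to the cone inside the ball, and `‖x‖ → 0` to infinity; only the cocore
plane `{0} × ℝ²` is new. The graph of the gluing map is closed (`isClosed_graph_traceGlue`: on it
`‖y‖ ‖x‖ = 1`), so the open trace is a Hausdorff (and second countable) smooth `4`-manifold charted
on `ℝ⁴`. The subset `inl(B̄⁴) ∪ inr(𝔻² × 𝔻²)` is the trace `B⁴ ∪_ν D² × D²` of the framed circle
(the handle meets the ball in `inl(ν(𝕊¹ × 𝔻²))`, `inl_eq_inr_iff`), whence the name.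

## Main statements (all proved; the definitions are constructions, not named facts)

* `TubeNbhd.traceCone`, `traceFwd`, `traceBwd`, `traceGlue`, `traceGlueData`, `OpenTrace`,
  `coreDisc`; `instT2SpaceOpenTrace`, σ-compactness and second countability.
* `TubeNbhd.isSliceDiscIn`: **for a knot `K` and a tube `ν` around it,
  `K.IsSliceDiscIn (OpenTrace ν) inl coreDisc`** — the `0`-handle chart and the core disc form a
  slice-disc datum (the core disc is a smooth injective immersion, equal to `inl ∘ K` on `𝕊¹`, and
  off its centre it is `inl (‖x‖⁻¹ • K(x/‖x‖))`, outside the closed ball).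
* `TubeNbhd.inl_mem_core_iff`, `inr_mem_core_iff`, `eq_inl_or_eq_inr_zero`: the core
  `C = inl(B̄⁴) ∪ coreDisc(𝔻²)` seen from the two charts — its complement is
  `inl {t • a | t > 1, a ∉ c(𝕊¹)} ∪ inr {(x, w) | ‖x‖ < 1, w ≠ 0}`, the two pieces from which the
  sequel assembles the collar `Y × ℝ`.

## References

* C. Manolescu, L. Piccirillo, *From zero surgeries to candidates for exotic definite
  4-manifolds*, J. Lond. Math. Soc. (2) 108 (2023), §3.2, Def. 3.4 and proof of Lemma 3.3
  [ManolescuPiccirillo2023].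
* R. C. Kirby, *The Topology of 4-Manifolds*, LNM 1374 (1989), Ch. I §1 (handles `Bᵏ × B⁴⁻ᵏ`),
  §2 (2-handles attached along framed knots) [Kirby1989].
* A. Kosinski, *Differential Manifolds* (1993), Ch. VI §1, proof of Thm. 1.1 (Hausdorffness of a
  gluing) [Kosinski1993].

## Design notes

* The `2`-handle chart is the normed space `ℝ² × ℝ²` charted on itself (model `𝓘(ℝ, ℝ² × ℝ²)`), so
  that maps into and out of it are plain `ContDiff` maps; the glued manifold is charted on `ℝ⁴` via
  `traceLinB : ℝ² × ℝ² ≃L ℝ⁴`.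
* Attaching the handle chart along the *whole* cone (all radii) rather than along a thin collar of
  the tube changes nothing (every point with `x ≠ 0` is identified with a point of `ℝ⁴` anyway) and
  makes the gluing map a one-line formula; the price is that the radius must blow up at the cocore
  (`t = ‖x‖⁻¹`), which is exactly what makes the graph closed.
* No declaration in this file uses `sorry`.
-/

open scoped Manifold ContDiff Topology
open Set Function Metric OpenPartialHomeomorph

noncomputable section

namespace Literature.Topology.FourManifolds

/-- Local notation: `𝔼 n` is the model Euclidean space `EuclideanSpace ℝ (Fin n)`. -/
local notation "𝔼 " n:arg => EuclideanSpace ℝ (Fin n)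

/-- Local notation: `𝕊 n` is the unit sphere in `EuclideanSpace ℝ (Fin (n + 1))`. -/
local notation "𝕊 " n:arg => (Metric.sphere (0 : EuclideanSpace ℝ (Fin (n + 1))) 1)

/-- Local notation: `𝔻²` is the closed unit disc in `ℝ²`. -/
local notation "𝔻²" => Metric.closedBall (0 : EuclideanSpace ℝ (Fin 2)) 1

namespace TubeNbhd

variable {c : 𝕊 1 → 𝕊 3} (ν : TubeNbhd (𝓡 3) c)

/-! ### The open cone over the tube and the two gluing maps -/

/-- The **open cone over the tube**: the nonzero vectors `y ∈ ℝ⁴` whose direction `y/‖y‖ ∈ S³`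
lies in the (open) tube `ν(𝕊¹ × ℝ²)`; the gluing region on the side of the `0`-handle chart `ℝ⁴`.
[folklore] -/
def traceCone : Set (𝔼 4) :=
  {y | y ≠ 0 ∧ radialProjection (spherePt 3) y ∈ range ν.toFun}

/-- The cone over the tube is open. [folklore] -/
theorem isOpen_traceCone : IsOpen ν.traceCone := by
  have h := (continuousOn_radialProjection (spherePt 3)).isOpen_inter_preimage isOpen_ne
    ν.isOpen_range
  exact h

/-- The **forward gluing map** `ℝ⁴ → ℝ² × ℝ²`: `t • ν(u, w) ↦ (t⁻¹ • u, w)` (`t > 0`), i.e.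
`y ↦ (‖y‖⁻¹ • u, w)` with `(u, w) = ν⁻¹(y/‖y‖)` (junk off the cone). Going out to infinity in the
cone (`t → ∞`) is approaching the cocore plane `{0} × ℝ²` of the `2`-handle chart. [folklore] -/
def traceFwd (y : 𝔼 4) : (𝔼 2) × (𝔼 2) :=
  (‖y‖⁻¹ • ((ν.toHomeo.symm (radialProjection (spherePt 3) y)).1 : 𝔼 2),
    (ν.toHomeo.symm (radialProjection (spherePt 3) y)).2)

/-- The **backward gluing map** `ℝ² × ℝ² → ℝ⁴`: `(x, w) ↦ ‖x‖⁻¹ • ν(x/‖x‖, w)` (junk on `x = 0`).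
[folklore] -/
def traceBwd (p : (𝔼 2) × (𝔼 2)) : 𝔼 4 :=
  ‖p.1‖⁻¹ • ((ν.toFun (radialProjection (spherePt 1) p.1, p.2) : 𝕊 3) : 𝔼 4)

/-- The forward map on a cone point `t • ν(u, w)`. [folklore] -/
theorem traceFwd_apply {t : ℝ} (ht : 0 < t) (q : (𝕊 1) × (𝔼 2)) :
    ν.traceFwd (t • ((ν.toFun q : 𝕊 3) : 𝔼 4)) = (t⁻¹ • (q.1 : 𝔼 2), q.2) := by
  simp only [traceFwd, radialProjection_smul _ ht, toHomeo_symm_apply, norm_smul_coe_sphere ht.le]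

/-- The backward map on `(t • u, w)`, `u ∈ 𝕊¹`, `t > 0`. [folklore] -/
theorem traceBwd_apply {t : ℝ} (ht : 0 < t) (u : 𝕊 1) (w : 𝔼 2) :
    ν.traceBwd (t • (u : 𝔼 2), w) = t⁻¹ • ((ν.toFun (u, w) : 𝕊 3) : 𝔼 4) := by
  simp only [traceBwd, radialProjection_smul _ ht, norm_smul_coe_sphere ht.le]

/-- `‖traceBwd (x, w)‖ = ‖x‖⁻¹` (the tube lies on the unit sphere). [folklore] -/
theorem norm_traceBwd (p : (𝔼 2) × (𝔼 2)) : ‖ν.traceBwd p‖ = ‖p.1‖⁻¹ := by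
  rw [traceBwd, norm_smul, norm_inv, norm_norm, norm_eq_of_mem_sphere, mul_one]

/-- `traceBwd ∘ traceFwd = id` on the cone. [folklore] -/
theorem traceBwd_traceFwd {y : 𝔼 4} (hy : y ∈ ν.traceCone) : ν.traceBwd (ν.traceFwd y) = y := by
  obtain ⟨hy0, q, hq⟩ := hy
  have hpos : 0 < ‖y‖ := norm_pos_iff.2 hy0
  have hy' : y = ‖y‖ • ((ν.toFun q : 𝕊 3) : 𝔼 4) := by
    rw [hq, norm_smul_coe_radialProjection]
  rw [hy', traceFwd_apply _ hpos, traceBwd_apply _ (inv_pos.2 hpos), inv_inv]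

/-- `traceFwd ∘ traceBwd = id` off `x = 0`. [folklore] -/
theorem traceFwd_traceBwd {p : (𝔼 2) × (𝔼 2)} (hp : p.1 ≠ 0) : ν.traceFwd (ν.traceBwd p) = p := by
  obtain ⟨x, w⟩ := p
  have hpos : 0 < ‖x‖ := norm_pos_iff.2 hp
  have hx : x = ‖x‖ • ((radialProjection (spherePt 1) x : 𝕊 1) : 𝔼 2) :=
    (norm_smul_coe_radialProjection _ x).symm
  conv_lhs => rw [hx]
  rw [traceBwd_apply _ hpos, traceFwd_apply _ (inv_pos.2 hpos), inv_inv, ← hx]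

/-- The backward map lands in the cone. [folklore] -/
theorem traceBwd_mem_traceCone {p : (𝔼 2) × (𝔼 2)} (hp : p.1 ≠ 0) : ν.traceBwd p ∈ ν.traceCone := by
  have hpos : 0 < ‖p.1‖ := norm_pos_iff.2 hp
  refine ⟨?_, ?_⟩
  · rw [← norm_ne_zero_iff, norm_traceBwd]
    exact (inv_pos.2 hpos).ne'
  · rw [traceBwd, radialProjection_smul _ (inv_pos.2 hpos)]
    exact mem_range_self _

/-- The forward map lands off `x = 0`. [folklore] -/
theorem traceFwd_fst_ne_zero {y : 𝔼 4} (hy : y ∈ ν.traceCone) : (ν.traceFwd y).1 ≠ 0 := by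
  obtain ⟨hy0, q, hq⟩ := hy
  have hpos : 0 < ‖y‖ := norm_pos_iff.2 hy0
  have hy' : y = ‖y‖ • ((ν.toFun q : 𝕊 3) : 𝔼 4) := by
    rw [hq, norm_smul_coe_radialProjection]
  rw [hy', traceFwd_apply _ hpos]
  exact smul_ne_zero (inv_pos.2 hpos).ne' (ne_zero_of_mem_unit_sphere q.1)

/-- `‖(traceFwd y).1‖ = ‖y‖⁻¹` on the cone. [folklore] -/
theorem norm_traceFwd_fst {y : 𝔼 4} (hy : y ∈ ν.traceCone) : ‖(ν.traceFwd y).1‖ = ‖y‖⁻¹ := by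
  obtain ⟨hy0, q, hq⟩ := hy
  have hpos : 0 < ‖y‖ := norm_pos_iff.2 hy0
  have hy' : y = ‖y‖ • ((ν.toFun q : 𝕊 3) : 𝔼 4) := by
    rw [hq, norm_smul_coe_radialProjection]
  rw [hy', traceFwd_apply _ hpos, norm_smul_coe_sphere (inv_pos.2 hpos).le,
    norm_smul_coe_sphere hpos.le]

/-! ### Smoothness of the gluing maps -/

/-- **The forward gluing map is smooth on the cone** (`y ↦ y/‖y‖` is smooth off the origin,
`ν⁻¹` is smooth on the open range of the tube, `y ↦ ‖y‖⁻¹` is smooth off the origin). [folklore] -/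
theorem contMDiffOn_traceFwd :
    ContMDiffOn 𝓘(ℝ, 𝔼 4) 𝓘(ℝ, (𝔼 2) × (𝔼 2)) ∞ ν.traceFwd ν.traceCone := by
  -- `Q := ν⁻¹ ∘ (y ↦ y/‖y‖)` is smooth on the cone
  have hQ : ContMDiffOn 𝓘(ℝ, 𝔼 4) ((𝓡 1).prod 𝓘(ℝ, 𝔼 2)) ∞
      (fun y ↦ ν.toHomeo.symm (radialProjection (spherePt 3) y)) ν.traceCone := by
    refine ν.contMDiffOn_toHomeo_symm.comp
      ((contMDiffOn_radialProjection (spherePt 3)).mono fun y hy ↦ hy.1) fun y hy ↦ hy.2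
  haveI : Fact (Module.finrank ℝ (𝔼 2) = 1 + 1) := ⟨by simp⟩
  have h1 : ContMDiffOn 𝓘(ℝ, 𝔼 4) 𝓘(ℝ, 𝔼 2) ∞
      (fun y ↦ (((ν.toHomeo.symm (radialProjection (spherePt 3) y)).1 : 𝕊 1) : 𝔼 2))
      ν.traceCone :=
    ((contMDiff_coe_sphere (E := 𝔼 2) (n := 1)).comp contMDiff_fst).comp_contMDiffOn hQ
  have h2 : ContMDiffOn 𝓘(ℝ, 𝔼 4) 𝓘(ℝ, 𝔼 2) ∞
      (fun y ↦ (ν.toHomeo.symm (radialProjection (spherePt 3) y)).2) ν.traceCone :=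
    contMDiff_snd.comp_contMDiffOn hQ
  have h3 : ContMDiffOn 𝓘(ℝ, 𝔼 4) 𝓘(ℝ, ℝ) ∞ (fun y : 𝔼 4 ↦ ‖y‖⁻¹) ν.traceCone := by
    intro y hy
    exact (((contDiffAt_norm ℝ hy.1).inv (norm_ne_zero_iff.2 hy.1)).contMDiffAt).contMDiffWithinAt
  have hsm : ContDiff ℝ ∞ (fun p : ℝ × (𝔼 2) ↦ p.1 • p.2) := contDiff_fst.smul contDiff_snd
  exact (hsm.contMDiff.comp_contMDiffOn (h3.prodMk_space h1)).prodMk_space h2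

/-- **The backward gluing map is smooth off `x = 0`.** [folklore] -/
theorem contMDiffOn_traceBwd :
    ContMDiffOn 𝓘(ℝ, (𝔼 2) × (𝔼 2)) 𝓘(ℝ, 𝔼 4) ∞ ν.traceBwd {p | p.1 ≠ 0} := by
  have hfst : ContMDiff 𝓘(ℝ, (𝔼 2) × (𝔼 2)) 𝓘(ℝ, 𝔼 2) ∞ (Prod.fst : (𝔼 2) × (𝔼 2) → 𝔼 2) :=
    contDiff_fst.contMDiff
  have hsnd : ContMDiff 𝓘(ℝ, (𝔼 2) × (𝔼 2)) 𝓘(ℝ, 𝔼 2) ∞ (Prod.snd : (𝔼 2) × (𝔼 2) → 𝔼 2) :=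
    contDiff_snd.contMDiff
  have hP : ContMDiffOn 𝓘(ℝ, (𝔼 2) × (𝔼 2)) ((𝓡 1).prod 𝓘(ℝ, 𝔼 2)) ∞
      (fun p : (𝔼 2) × (𝔼 2) ↦ (radialProjection (spherePt 1) p.1, p.2)) {p | p.1 ≠ 0} :=
    ((contMDiffOn_radialProjection (spherePt 1)).comp hfst.contMDiffOn fun p hp ↦ hp).prodMk
      hsnd.contMDiffOn
  haveI : Fact (Module.finrank ℝ (𝔼 4) = 3 + 1) := ⟨by simp⟩
  have hν : ContMDiffOn 𝓘(ℝ, (𝔼 2) × (𝔼 2)) 𝓘(ℝ, 𝔼 4) ∞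
      (fun p : (𝔼 2) × (𝔼 2) ↦ ((ν.toFun (radialProjection (spherePt 1) p.1, p.2) : 𝕊 3) : 𝔼 4))
      {p | p.1 ≠ 0} :=
    ((contMDiff_coe_sphere (E := 𝔼 4) (n := 3)).comp ν.contMDiff).comp_contMDiffOn hP
  have h3 : ContMDiffOn 𝓘(ℝ, (𝔼 2) × (𝔼 2)) 𝓘(ℝ, ℝ) ∞ (fun p : (𝔼 2) × (𝔼 2) ↦ ‖p.1‖⁻¹)
      {p | p.1 ≠ 0} := by
    intro p hp
    have : ContDiffAt ℝ ∞ (fun p : (𝔼 2) × (𝔼 2) ↦ ‖p.1‖⁻¹) p :=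
      ((contDiffAt_norm ℝ (hp : p.1 ≠ 0)).comp p contDiffAt_fst).inv (norm_ne_zero_iff.2 hp)
    exact this.contMDiffAt.contMDiffWithinAt
  have hsm : ContDiff ℝ ∞ (fun p : ℝ × (𝔼 4) ↦ p.1 • p.2) := contDiff_fst.smul contDiff_snd
  exact hsm.contMDiff.comp_contMDiffOn (h3.prodMk_space hν)

/-! ### The gluing partial diffeomorphism and the open trace -/

/-- **The gluing partial diffeomorphism of the open trace**: the open cone over the tube in
`ℝ⁴` onto `(ℝ² ∖ 0) × ℝ²`, `t • ν(u, w) ↦ (t⁻¹ • u, w)`. [folklore] -/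
def traceGlue : OpenPartialHomeomorph (𝔼 4) ((𝔼 2) × (𝔼 2)) where
  toFun := ν.traceFwd
  invFun := ν.traceBwd
  source := ν.traceCone
  target := {p | p.1 ≠ 0}
  map_source' _ hy := ν.traceFwd_fst_ne_zero hy
  map_target' _ hp := ν.traceBwd_mem_traceCone hp
  left_inv' _ hy := ν.traceBwd_traceFwd hy
  right_inv' _ hp := ν.traceFwd_traceBwd hp
  open_source := ν.isOpen_traceCone
  open_target := isOpen_ne.preimage continuous_fst
  continuousOn_toFun := ν.contMDiffOn_traceFwd.continuousOn
  continuousOn_invFun := ν.contMDiffOn_traceBwd.continuousOn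

/-- The source of the gluing map is the cone over the tube. [folklore] -/
@[simp] theorem traceGlue_source : ν.traceGlue.source = ν.traceCone := rfl

/-- The target of the gluing map is `(ℝ² ∖ 0) × ℝ²`. [folklore] -/
@[simp] theorem traceGlue_target : ν.traceGlue.target = {p : (𝔼 2) × (𝔼 2) | p.1 ≠ 0} := rfl

/-- The gluing map is `traceFwd`. [folklore] -/
@[simp] theorem traceGlue_apply (y : 𝔼 4) : ν.traceGlue y = ν.traceFwd y := rfl

/-- The inverse gluing map is `traceBwd`. [folklore] -/
@[simp] theorem traceGlue_symm_apply (p : (𝔼 2) × (𝔼 2)) : ν.traceGlue.symm p = ν.traceBwd p := rfl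

/-- The identification `ℝ² × ℝ² ≃L ℝ⁴` of the model vector spaces (equal dimension). [folklore] -/
def traceLinB : ((𝔼 2) × (𝔼 2)) ≃L[ℝ] 𝔼 4 :=
  ContinuousLinearEquiv.ofFinrankEq (by simp)

/-- **The gluing partial diffeomorphism of the open trace**: the open cone over the tube in
`ℝ⁴` onto `(ℝ² ∖ 0) × ℝ²`, `t • ν(u, w) ↦ (t⁻¹ • u, w)`. [folklore] -/
def traceGlueData : SmoothGlueData (𝓡 4) 𝓘(ℝ, (𝔼 2) × (𝔼 2)) (𝔼 4) ((𝔼 2) × (𝔼 2)) (𝔼 4) where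
  glue := ν.traceGlue
  contMDiffOn_glue := ν.contMDiffOn_traceFwd
  contMDiffOn_glue_symm := ν.contMDiffOn_traceBwd
  linA := ContinuousLinearEquiv.refl ℝ (𝔼 4)
  linB := traceLinB

/-- The gluing map of the datum is `traceGlue`. [folklore] -/
@[simp] theorem traceGlueData_glue : ν.traceGlueData.glue = ν.traceGlue := rfl

/-- **The open trace** of the framed circle `(c, ν)` in `S³`: the smooth `4`-manifold
`ℝ⁴ ∪_{traceGlue} (ℝ² × ℝ²)` (a `SmoothGlueData.Glued`, charted on `ℝ⁴`, `C^∞`). As a set it is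
`ℝ⁴ ⊔ ({0} × ℝ²)`: the `2`-handle chart `ℝ²_x × ℝ²_w` is attached to `ℝ⁴` along `x ≠ 0`, the cocore
plane `{0} × ℝ²_w` being added "at infinity" of the cone over the tube. The compact subset
`inl(B̄⁴) ∪ inr(𝔻² × 𝔻²)` is a copy of the trace `X = B⁴ ∪_ν (D² × D²)` — the `2`-handle
`inr(𝔻² × 𝔻²)` meets the `0`-handle `inl(B̄⁴)` exactly in `inr(∂𝔻² × 𝔻²) = inl(ν(𝕊¹ × 𝔻²)) ⊆ S³`
(`inl_eq_inr_iff`) — and its complement is an open collar of `∂X`, so `OpenTrace ν` is the interior of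
the trace with an open collar attached (Manolescu–Piccirillo, Def. 3.4: "The trace of a knot `K`,
denoted `X(K)`, is the 4-manifold obtained by attaching a single 0-framed 2-handle to `B⁴` along `K`";
here the framing is the one carried by `ν`; Kirby (1989), Ch. I §§1–2; Gompf–Stipsicz (1999), §4.1).
[cite: ManolescuPiccirillo2023, §3.2 Def. 3.4] [cite: Kirby1989, Ch. I §2] -/
abbrev OpenTrace : Type := ν.traceGlueData.Glued

/-- **The identification of the two charts**: `inl y = inr (x, w)` iff `x ≠ 0` and
`y = ‖x‖⁻¹ • ν(x/‖x‖, w)`. [folklore] -/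
theorem inl_eq_inr_iff {y : 𝔼 4} {p : (𝔼 2) × (𝔼 2)} :
    ν.traceGlueData.inl y = ν.traceGlueData.inr p ↔ p.1 ≠ 0 ∧ ν.traceBwd p = y := by
  rw [SmoothGlueData.inl_eq_inr_iff, traceGlueData_glue, traceGlue_source, traceGlue_apply]
  constructor
  · rintro ⟨hy, rfl⟩
    exact ⟨ν.traceFwd_fst_ne_zero hy, ν.traceBwd_traceFwd hy⟩
  · rintro ⟨hp, rfl⟩
    exact ⟨ν.traceBwd_mem_traceCone hp, ν.traceFwd_traceBwd hp⟩

/-- **The graph of the gluing map is closed** in `ℝ⁴ × (ℝ² × ℝ²)`: it is the graph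
`{(traceBwd p, p) | p.1 ≠ 0}` of a map continuous on the open set `{x ≠ 0}`, and it has no limit
point over `x = 0` because `‖y‖ ‖x‖ = 1` on it (going to the cocore plane is going to infinity in
`ℝ⁴`). Hence the open trace is Hausdorff (Kosinski (1993), VI §1, proof of Thm. 1.1).
[cite: Kosinski1993, Ch. VI §1, proof of Thm. 1.1] -/
theorem isClosed_graph_traceGlue :
    IsClosed {q : (𝔼 4) × ((𝔼 2) × (𝔼 2)) | q.1 ∈ ν.traceGlue.source ∧ ν.traceGlue q.1 = q.2} := by
  -- the graph is `{(y, p) | p.1 ≠ 0 ∧ y = traceBwd p}`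
  have hG : {q : (𝔼 4) × ((𝔼 2) × (𝔼 2)) | q.1 ∈ ν.traceGlue.source ∧ ν.traceGlue q.1 = q.2} =
      {q | q.2.1 ≠ 0 ∧ ν.traceBwd q.2 = q.1} := by
    ext ⟨y, p⟩
    simp only [mem_setOf_eq, traceGlue_source, traceGlue_apply]
    constructor
    · rintro ⟨hy, rfl⟩
      exact ⟨ν.traceFwd_fst_ne_zero hy, ν.traceBwd_traceFwd hy⟩
    · rintro ⟨hp, rfl⟩
      exact ⟨ν.traceBwd_mem_traceCone hp, ν.traceFwd_traceBwd hp⟩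
  rw [hG, isClosed_iff_nhds]
  rintro ⟨y, p⟩ H
  by_cases hp : p.1 ≠ 0
  · -- near `p`, the graph of the continuous `traceBwd`
    refine ⟨hp, ?_⟩
    by_contra hne
    obtain ⟨W₁, W₂, hW₁, hW₂, h₁, h₂, hW⟩ := t2_separation hne
    have ho : IsOpen {p : (𝔼 2) × (𝔼 2) | p.1 ≠ 0} := isOpen_ne.preimage continuous_fst
    have hUo : IsOpen ({p : (𝔼 2) × (𝔼 2) | p.1 ≠ 0} ∩ ν.traceBwd ⁻¹' W₁) :=
      ν.contMDiffOn_traceBwd.continuousOn.isOpen_inter_preimage ho hW₁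
    obtain ⟨⟨y', p'⟩, ⟨hy'W, hp'U⟩, -, hq⟩ := H (W₂ ×ˢ ({p : (𝔼 2) × (𝔼 2) | p.1 ≠ 0} ∩ ν.traceBwd ⁻¹' W₁))
      (prod_mem_nhds (hW₂.mem_nhds h₂) (hUo.mem_nhds ⟨hp, h₁⟩))
    dsimp only at hq hy'W hp'U
    rw [← hq] at hy'W
    exact Set.disjoint_left.1 hW hp'U.2 hy'W
  · -- `p.1 = 0`: no graph point is close, as `‖y'‖ ‖p'.1‖ = 1` on the graph
    exfalso
    rw [not_not] at hp
    set R : ℝ := ‖y‖ + 1 with hR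
    have hRpos : 0 < R := by positivity
    have hU : Metric.ball y 1 ×ˢ {p' : (𝔼 2) × (𝔼 2) | ‖p'.1‖ < R⁻¹} ∈ 𝓝 (y, p) := by
      refine prod_mem_nhds (Metric.ball_mem_nhds y one_pos) ((isOpen_lt (continuous_norm.comp
        continuous_fst) continuous_const).mem_nhds ?_)
      simp [hp, inv_pos.2 hRpos]
    obtain ⟨⟨y', p'⟩, ⟨hy', hp'⟩, hp'0, hq⟩ := H _ hU
    dsimp only at hq hy' hp' hp'0
    simp only [mem_setOf_eq, Metric.mem_ball] at hy' hp'
    have h1 : ‖ν.traceBwd p'‖ = ‖p'.1‖⁻¹ := ν.norm_traceBwd p'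
    rw [← hq] at hy'
    have h2 : ‖ν.traceBwd p'‖ < R := by
      have := norm_sub_norm_le (ν.traceBwd p') y
      rw [← dist_eq_norm] at this
      linarith
    have h3 : R < ‖p'.1‖⁻¹ := by
      rw [lt_inv_comm₀ hRpos (norm_pos_iff.2 hp'0)]
      exact hp'
    linarith

/-- **The open trace is Hausdorff.** [cite: Kosinski1993, Ch. VI §1, proof of Thm. 1.1] -/
instance : T2Space ν.OpenTrace :=
  ν.traceGlueData.t2Space_of_isClosed_graph ν.isClosed_graph_traceGlue

/-- A point of the `2`-handle chart lies in the `0`-handle chart iff it is off the cocore plane.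
[folklore] -/
theorem inr_mem_range_inl_iff {p : (𝔼 2) × (𝔼 2)} :
    ν.traceGlueData.inr p ∈ range ν.traceGlueData.inl ↔ p.1 ≠ 0 := by
  rw [SmoothGlueData.inr_mem_range_inl_iff, traceGlueData_glue, traceGlue_target, mem_setOf_eq]

/-! ### The core disc of the `2`-handle -/

/-- **The core disc of the `2`-handle**, extended to the whole core plane: `x ↦ inr (x, 0)`. On the
closed unit disc it is the core `D² × {0}` of the handle `inr(𝔻² × 𝔻²)`, with boundary the framed
circle `inl ∘ c` on `S³ = ∂B̄⁴` (`coreDisc_coe_sphere`); for `0 < ‖x‖ < 1` it runs radially outside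
the ball, `coreDisc x = inl (‖x‖⁻¹ • c(x/‖x‖))` (`coreDisc_eq_inl`). [cite: Kirby1989, Ch. I §2] -/
def coreDisc (x : 𝔼 2) : ν.OpenTrace := ν.traceGlueData.inr (x, 0)

/-- Unfolding of `coreDisc`. [folklore] -/
theorem coreDisc_apply (x : 𝔼 2) : ν.coreDisc x = ν.traceGlueData.inr (x, 0) := rfl

/-- Off the centre, the core disc is the radial cone over the circle in the `0`-handle chart:
`coreDisc x = inl (‖x‖⁻¹ • c(x/‖x‖))`. [folklore] -/
theorem coreDisc_eq_inl {x : 𝔼 2} (hx : x ≠ 0) :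
    ν.coreDisc x = ν.traceGlueData.inl (ν.traceBwd (x, 0)) :=
  (ν.inl_eq_inr_iff.2 ⟨hx, rfl⟩).symm

/-- **The boundary of the core disc is the attaching circle**: `coreDisc u = inl (c u)` for
`u ∈ 𝕊¹`. [cite: Kirby1989, Ch. I §2] -/
theorem coreDisc_coe_sphere (u : 𝕊 1) :
    ν.coreDisc u = ν.traceGlueData.inl ((c u : 𝕊 3) : 𝔼 4) := by
  rw [ν.coreDisc_eq_inl (ne_zero_of_mem_unit_sphere u)]
  congr 1
  have : ((u : 𝔼 2), (0 : 𝔼 2)) = ((1 : ℝ) • (u : 𝔼 2), (0 : 𝔼 2)) := by rw [one_smul]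
  rw [this, ν.traceBwd_apply one_pos, inv_one, one_smul, ν.apply_zero]

/-- The core disc is smooth. [folklore] -/
theorem contMDiff_coreDisc : ContMDiff (𝓡 2) (𝓡 4) ∞ ν.coreDisc := by
  have h : ContMDiff 𝓘(ℝ, 𝔼 2) 𝓘(ℝ, (𝔼 2) × (𝔼 2)) ∞ fun x : 𝔼 2 ↦ (x, (0 : 𝔼 2)) :=
    (contDiff_id.prodMk contDiff_const).contMDiff
  exact ν.traceGlueData.contMDiff_inr.comp h

/-- The core disc is injective. [folklore] -/
theorem injective_coreDisc : Injective ν.coreDisc := fun x y h ↦ by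
  have := ν.traceGlueData.inr_injective h
  simpa using this

/-- The `2`-handle chart has injective differential (it is an immersion). [folklore] -/
theorem injective_mfderiv_inr (p : (𝔼 2) × (𝔼 2)) :
    Injective (mfderiv 𝓘(ℝ, (𝔼 2) × (𝔼 2)) (𝓡 4) ν.traceGlueData.inr p) := by
  obtain ⟨F, _, _, hF⟩ := ν.traceGlueData.isSmoothEmbedding_inr.isImmersion
  exact Manifold.IsImmersionAtOfComplement.mfderiv_injective (hF p) (by simp)

/-- The `0`-handle chart has injective differential (it is an immersion). [folklore] -/
theorem injective_mfderiv_inl (y : 𝔼 4) :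
    Injective (mfderiv (𝓡 4) (𝓡 4) ν.traceGlueData.inl y) := by
  obtain ⟨F, _, _, hF⟩ := ν.traceGlueData.isSmoothEmbedding_inl.isImmersion
  exact Manifold.IsImmersionAtOfComplement.mfderiv_injective (hF y) (by simp)

/-- The core disc is an immersion. [folklore] -/
theorem injective_mfderiv_coreDisc (x : 𝔼 2) : Injective (mfderiv (𝓡 2) (𝓡 4) ν.coreDisc x) := by
  have hn : (∞ : ℕ∞ω) ≠ 0 := by simp
  let ι : (𝔼 2) →L[ℝ] (𝔼 2) × (𝔼 2) := ContinuousLinearMap.inl ℝ (𝔼 2) (𝔼 2)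
  have hι : (fun x : 𝔼 2 ↦ ((x, 0) : (𝔼 2) × (𝔼 2))) = ι := by
    funext x; simp [ι]
  have hcd : ν.coreDisc = ν.traceGlueData.inr ∘ ι := by
    funext x; simp [coreDisc_apply, ι]
  rw [hcd, mfderiv_comp x (ν.traceGlueData.contMDiff_inr.mdifferentiableAt hn)
    ι.hasMFDerivAt.mdifferentiableAt, ι.mfderiv_eq]
  intro v w hvw
  have h1 : ι v = ι w := ν.injective_mfderiv_inr (ι x) hvw
  have h2 : @Eq (𝔼 2) v w := by simpa [ι] using h1
  exact h2

/-- **The core of the `2`-handle is a proper disc for the knot off the `0`-handle.** For a knot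
`K` and a tube `ν` around it, the `0`-handle chart `inl : ℝ⁴ ↪ OpenTrace ν` and the core disc form a
slice-disc datum `K.IsSliceDiscIn (OpenTrace ν) inl coreDisc` (`HomotopyBallSlice.lean`): `inl` is a
smooth embedding, `coreDisc` is a smooth injective immersion, the open unit disc avoids `inl(B̄⁴)`
(its points off the centre are `inl` of vectors of norm `‖x‖⁻¹ > 1`, its centre is on the cocore
plane), and `coreDisc = inl ∘ K` on `𝕊¹`. This is the datum `(e, f)` required of the open trace by
the leaf `Knot.exists_openTrace_of_isIntegralSurgery` of `ZeroSurgeryHomotopyBallSliceConstruction.lean`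
(Manolescu–Piccirillo, proof of Lemma 3.3: "`K' ⊂ S³ ⊂ ∂(X°(−K'))` bounds a disk `D` in `X°(−K')`
made up of the product cobordism in `S³ × I` and the core of the 2-handle").
[cite: ManolescuPiccirillo2023, §3.2, proof of Lemma 3.3] -/
theorem isSliceDiscIn (K : Knot) (ν : TubeNbhd (𝓡 3) K) :
    K.IsSliceDiscIn ν.OpenTrace ν.traceGlueData.inl ν.coreDisc := by
  refine ⟨ν.traceGlueData.isSmoothEmbedding_inl, ν.contMDiff_coreDisc,
    ν.injective_coreDisc.injOn, fun x _ ↦ ν.injective_mfderiv_coreDisc x, ?_, ?_⟩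
  · rintro x hx ⟨y, hy, hxy⟩
    by_cases hx0 : x = 0
    · subst hx0
      have : ν.traceGlueData.inr ((0 : 𝔼 2), (0 : 𝔼 2)) ∈ range ν.traceGlueData.inl := ⟨y, hxy⟩
      rw [ν.inr_mem_range_inl_iff] at this
      exact this rfl
    · rw [ν.coreDisc_eq_inl hx0, ν.traceGlueData.inl_injective.eq_iff] at hxy
      rw [Metric.mem_closedBall, dist_zero_right, hxy, ν.norm_traceBwd] at hy
      have : (1 : ℝ) < ‖x‖⁻¹ := (one_lt_inv₀ (norm_pos_iff.2 hx0)).2 hx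
      linarith
  · intro u
    exact ν.coreDisc_coe_sphere u

/-! ### The compact core `C = B̄⁴ ∪ D` and its complement -/

/-- **Points of the `2`-handle chart in the core `C = inl(B̄⁴) ∪ coreDisc(𝔻²)`**: `inr (x, w) ∈ C`
iff `‖x‖ ≥ 1` (then it is `inl` of a vector of norm `‖x‖⁻¹ ≤ 1`) or `w = 0`, `‖x‖ ≤ 1` (the core
disc). So the handle chart meets the complement of `C` in `{‖x‖ < 1, w ≠ 0} ≅ D̊² × (ℝ² ∖ 0)`.
[folklore] -/
theorem inr_mem_core_iff {x w : 𝔼 2} :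
    ν.traceGlueData.inr (x, w) ∈
        ν.traceGlueData.inl '' Metric.closedBall (0 : 𝔼 4) 1 ∪ ν.coreDisc '' 𝔻² ↔
      1 ≤ ‖x‖ ∨ (w = 0 ∧ ‖x‖ ≤ 1) := by
  constructor
  · rintro (⟨y, hy, hxy⟩ | ⟨x', hx', hxx'⟩)
    · have hmem : ν.traceGlueData.inr (x, w) ∈ range ν.traceGlueData.inl := ⟨y, hxy⟩
      rw [ν.inr_mem_range_inl_iff] at hmem
      obtain ⟨-, h⟩ := ν.inl_eq_inr_iff.1 hxy
      subst h
      rw [Metric.mem_closedBall, dist_zero_right, ν.norm_traceBwd] at hy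
      exact Or.inl ((inv_le_one₀ (norm_pos_iff.2 hmem)).1 hy)
    · rw [coreDisc_apply, ν.traceGlueData.inr_injective.eq_iff, Prod.mk.injEq] at hxx'
      obtain ⟨rfl, rfl⟩ := hxx'
      rw [Metric.mem_closedBall, dist_zero_right] at hx'
      exact Or.inr ⟨rfl, hx'⟩
  · rintro (hx | ⟨rfl, hx⟩)
    · have hx0 : x ≠ 0 := by
        rintro rfl; norm_num at hx
      refine Or.inl ⟨ν.traceBwd (x, w), ?_, (ν.inl_eq_inr_iff.2 ⟨hx0, rfl⟩)⟩
      rw [Metric.mem_closedBall, dist_zero_right, ν.norm_traceBwd]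
      exact inv_le_one_of_one_le₀ hx
    · exact Or.inr ⟨x, by simpa using hx, rfl⟩

/-- **Points of the `0`-handle chart in the core `C = inl(B̄⁴) ∪ coreDisc(𝔻²)`**: `inl y ∈ C` iff
`‖y‖ ≤ 1` or `y = t • c(u)` with `t ≥ 1` (the radial cylinder over the circle, which is the part of
the core disc inside the `0`-handle chart). So the `0`-handle chart meets the complement of `C` in
`{t • a | t > 1, a ∈ S³ ∖ c(𝕊¹)} ≅ (S³ ∖ c) × (1, ∞)`. [folklore] -/
theorem inl_mem_core_iff {y : 𝔼 4} :
    ν.traceGlueData.inl y ∈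
        ν.traceGlueData.inl '' Metric.closedBall (0 : 𝔼 4) 1 ∪ ν.coreDisc '' 𝔻² ↔
      ‖y‖ ≤ 1 ∨ ∃ (u : 𝕊 1) (t : ℝ), 1 ≤ t ∧ y = t • ((c u : 𝕊 3) : 𝔼 4) := by
  constructor
  · rintro (⟨y', hy', hyy'⟩ | ⟨x, hx, hxy⟩)
    · rw [ν.traceGlueData.inl_injective.eq_iff] at hyy'
      subst hyy'
      rw [Metric.mem_closedBall, dist_zero_right] at hy'
      exact Or.inl hy'
    · have hx0 : x ≠ 0 := by
        rintro rfl
        have : ν.traceGlueData.inr ((0 : 𝔼 2), (0 : 𝔼 2)) ∈ range ν.traceGlueData.inl := ⟨y, hxy.symm⟩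
        rw [ν.inr_mem_range_inl_iff] at this
        exact this rfl
      rw [ν.coreDisc_eq_inl hx0, ν.traceGlueData.inl_injective.eq_iff] at hxy
      have hpos : 0 < ‖x‖ := norm_pos_iff.2 hx0
      refine Or.inr ⟨radialProjection (spherePt 1) x, ‖x‖⁻¹, ?_, ?_⟩
      · rw [Metric.mem_closedBall, dist_zero_right] at hx
        exact (one_le_inv₀ hpos).2 hx
      · rw [← hxy]
        conv_lhs => rw [← norm_smul_coe_radialProjection (spherePt 1) x]
        rw [ν.traceBwd_apply hpos, ν.apply_zero]
  · rintro (hy | ⟨u, t, ht, rfl⟩)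
    · exact Or.inl ⟨y, by simpa using hy, rfl⟩
    · have htpos : 0 < t := one_pos.trans_le ht
      refine Or.inr ⟨t⁻¹ • (u : 𝔼 2), ?_, ?_⟩
      · rw [Metric.mem_closedBall, dist_zero_right, norm_smul_coe_sphere (inv_pos.2 htpos).le]
        exact inv_le_one_of_one_le₀ ht
      · rw [ν.coreDisc_eq_inl (smul_ne_zero (inv_pos.2 htpos).ne' (ne_zero_of_mem_unit_sphere u)),
          ν.traceBwd_apply (inv_pos.2 htpos), inv_inv, ν.apply_zero]

/-- Every point of the open trace lies in the `0`-handle chart or on the cocore plane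
`inr({0} × ℝ²)`. [folklore] -/
theorem eq_inl_or_eq_inr_zero (z : ν.OpenTrace) :
    (∃ y, ν.traceGlueData.inl y = z) ∨ ∃ w, ν.traceGlueData.inr (0, w) = z := by
  obtain (h | ⟨⟨x, w⟩, rfl⟩) := ν.traceGlueData.exists_inl_or_inr z
  · exact Or.inl h
  · by_cases hx : x = 0
    · subst hx; exact Or.inr ⟨w, rfl⟩
    · exact Or.inl ⟨_, ν.inl_eq_inr_iff.2 ⟨hx, rfl⟩⟩

/-- The open trace is σ-compact (covered by the images of two σ-compact charts). [folklore] -/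
instance : SigmaCompactSpace ν.OpenTrace := by
  rw [← isSigmaCompact_univ_iff, ← ν.traceGlueData.range_inl_union_range_inr, union_eq_iUnion]
  exact isSigmaCompact_iUnion _ fun b ↦ by
    cases b
    · exact isSigmaCompact_range ν.traceGlueData.continuous_inr
    · exact isSigmaCompact_range ν.traceGlueData.continuous_inl

/-- The open trace is second countable. [folklore] -/
instance : SecondCountableTopology ν.OpenTrace := ν.traceGlueData.secondCountableTopology

end TubeNbhd

end Literature.Topology.FourManifolds

end
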